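import Summits.BirchSwinnertonDyer.BirchSwinnertonDyer.Theses.ResidualThetaTransportAtTwo
import Summits.BirchSwinnertonDyer.BirchSwinnertonDyer.Theorems.ResidualThetaTransportAtTwoSignedMuVanishingAtTwoPlusResidual
import Literature.NumberTheory.EllipticCurves.Kobayashi2003.SignedSelmerDualExistsProofs
import HarnessLib

/-!
# Line `layer-rank-certificate` for the crux `SignedMuSeedAtTwoPlus` (stmt-BirchSwinnertonDyer-21438)

Residual layer-rank certificate: for a finitely generated `Λ = ℤ₂⟦T⟧`-module `X`, the residual
module `X/2X` over `Ω = 𝔽₂⟦T⟧` is `Ω^r ⊕ ⨁ Ω/T^{aᵢ}`, and `#(X/(2,T^q)X) = 2^{rq + Σ min(aᵢ,q)}`.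
Hence `#(X/(2,T^q)X) < 2^{q-1} · #(X/(2,T)X)` for ONE `q ≥ 1` forces `r = 0`, i.e. `X/2X` finite,
i.e. `X` is `Λ`-torsion with `μ = 0` (`isTorsion_and_mu_eq_zero_iff_finite_quotient`, landed).
For `X = X⁺(A/ℚ_∞)` (dual signed Selmer), `X/(2,T^q)X` is Pontryagin dual to
`Sel⁺(A/ℚ_∞)[2][(γ-1)^q]`; with `q = q⁺ₙ = deg ω⁺ₙ = (2^{2⌊n/2⌋+1}+1)/3` Kobayashi's `ω⁺ₙ`-control
(`ω⁺ₙ ≡ T^{q⁺ₙ} mod 2`) bounds that group by the finite-layer group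
`Sel⁺(A/ℚ_n)[2][(σ-1)^{q⁺ₙ}]` for a CLEAN member `A` (semistable, odd Tamagawa: no descent defect
away from 2), and `#Sel⁺(A/ℚ_∞)[2]^Γ ≥ #Sel_{2^∞}(A/ℚ)[2]`. So ONE finite plus-2-descent over a
cyclotomic layer `ℚ_n` certifies the seed. BSD is not proved here; this is one line on one crux.
-/

open scoped Classical

open Summit.BirchSwinnertonDyer.BirchSwinnertonDyer.Theses.ResidualThetaTransportAtTwo
open Summit.BirchSwinnertonDyer.BirchSwinnertonDyer.Theorems.SignedMuAtTwo
open Literature.NumberTheory.EllipticCurves Literature.NumberTheory.EllipticCurves.IwasawaAlgebra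
  Literature.NumberTheory.EllipticCurves.Kobayashi2003 Literature.NumberTheory.EllipticCurves.Rank1Residual
  IsDedekindDomain NumberField

namespace Summit.BirchSwinnertonDyer.BirchSwinnertonDyer.Cruxes.SignedMuSeedAtTwoPlus.LayerRankCertificate

/-- `q⁺ₙ = deg ω⁺ₙ = 1 + Σ_{2 ≤ m ≤ n, m even} 2^{m-1} = (2^{2⌊n/2⌋+1}+1)/3` (= 1,1,3,3,11,11,43,…):
the `ℤ₂`-rank of Kobayashi's `E⁺(ℚ_{n,𝔭})` and the exponent with `ω⁺ₙ ≡ T^{q⁺ₙ} (mod 2)`. -/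
def qPlus (n : ℕ) : ℕ := (2 ^ (2 * (n / 2) + 1) + 1) / 3

/-- `conj_σ` on `H¹(Gal(ℚ̄/L), A[2^∞])` (`conjH1`) viewed in the endomorphism RING, so that
`(conj_γ - 1)^q` makes sense. -/
noncomputable def conjEnd (A : WeierstrassCurve ℚ) (H : Subgroup (Field.absoluteGaloisGroup ℚ))
    [H.Normal] (σ : Field.absoluteGaloisGroup ℚ) : AddMonoid.End (A.subgroupH1 2 H) :=
  A.conjH1 2 H σ

/-- The residual layer ideal `(p, T^q) ⊂ Λ = ℤ_p⟦T⟧`. -/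
noncomputable def layerIdeal (p : ℕ) [Fact p.Prime] (q : ℕ) : Ideal (IwasawaAlgebra p) :=
  Ideal.span {PowerSeries.C (p : ℤ_[p]), (PowerSeries.X : IwasawaAlgebra p) ^ q}

/-- **S1 · residual layer-rank criterion** (pure `Λ`-algebra, any `p`): if for some `q ≥ 1` the finite
quotient `X/(p,T^q)X` is smaller than `p^{q-1} · #(X/(p,T)X)`, then `X/pX` is finite (so `X` is
torsion with `μ = 0`). Proof idea: `X/pX ≅ Ω^r ⊕ ⨁ Ω/T^{aᵢ}` over the DVR `Ω = 𝔽_p⟦T⟧`;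
`log_p #(X/(p,T^q)X) - log_p #(X/(p,T)X) = r(q-1) + Σ (min(aᵢ,q) - 1) ≥ r(q-1)`. -/
def ResidualLayerRank : Prop :=
  ∀ (p : ℕ) [Fact p.Prime] (X : Type) [AddCommGroup X] [Module (IwasawaAlgebra p) X]
    [Module.Finite (IwasawaAlgebra p) X] (q : ℕ), 1 ≤ q →
    Nat.card (X ⧸ (layerIdeal p q • ⊤ : Submodule (IwasawaAlgebra p) X)) <
        p ^ (q - 1) * Nat.card (X ⧸ (layerIdeal p 1 • ⊤ : Submodule (IwasawaAlgebra p) X)) →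
      Finite (X ⧸ (augIdealP p • ⊤ : Submodule (IwasawaAlgebra p) X))

/-- **S2 · layer-fixed dictionary** (Pontryagin duality through `SignedSelmerDualData.toDual`,
`toDual_T_smul`): `#(X/(p,T^q)X) = #{s ∈ Sel^ε(E/K_∞) : p•s = 0, (conj_γ - 1)^q s = 0}`. -/
def LayerFixedDual : Prop :=
  ∀ {K : Type} [Field K] [NumberField K] (W : WeierstrassCurve K) {p : ℕ} [Fact p.Prime]
    (κ : ZpExtension K p) (γ : Field.absoluteGaloisGroup K) (ε : ℤˣ), κ.IsTopGenerator γ →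
    ∀ (D : SignedSelmerDualData W κ γ ε) [Module.Finite (IwasawaAlgebra p) D.X] (q : ℕ),
      ∃ F : Finset (signedSelmerInfty W κ ε),
        (∀ s, s ∈ F ↔ (p • s = 0 ∧ ((conjSignedSelmerInfty W κ ε γ - 1) ^ q) s = 0)) ∧
        F.card = Nat.card (D.X ⧸ (layerIdeal p q • ⊤ : Submodule (IwasawaAlgebra p) D.X))

/-- **S3 · plus-Kummer descent at 2 on the `ω⁺ₙ`-torsion** (Kobayashi (9.33) / Lemma 8.17 at `p = 2`,
`a₂ = 0`, Honda type `X² + 2`; local and the same for every habitat curve): a `2`-torsion class over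
`ℚ_n` killed by `(conj_γ - 1)^{q⁺ₙ}` whose restriction to `ℚ_m` satisfies the plus-Kummer condition at
the place above `2` already satisfies it over `ℚ_n` (`(E⁺(ℚ_{m,𝔭}) ⊗ ℚ₂/ℤ₂)[ω⁺ₙ] = E⁺(ℚ_{n,𝔭}) ⊗ ℚ₂/ℤ₂`). -/
def PlusKummerDescentAtTwo : Prop :=
  ∀ (A : WeierstrassCurve ℚ) [A.IsElliptic] [A.IsGloballyMinimal], GoodSS A 2 → A.frobeniusTrace 2 = 0 →
    ∀ (κ : ZpExtension ℚ 2) (γ : Field.absoluteGaloisGroup ℚ), κ.IsCyclotomic → κ.IsTopGenerator γ →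
    ∀ (v : HeightOneSpectrum (𝓞 ℚ)), ((2 : ℕ) : 𝓞 ℚ) ∈ v.asIdeal →
    ∀ (n m : ℕ) (hnm : n ≤ m) (c : A.subgroupH1 2 (κ.layerSubgroup n)),
      2 • c = 0 → ((conjEnd A (κ.layerSubgroup n) γ - 1) ^ qPlus n) c = 0 →
      (∀ σ : Field.absoluteGaloisGroup ℚ,
        A.conjH1 2 (κ.layerSubgroup m) σ (A.resOfLe 2 (κ.layerSubgroup_antitone hnm) c) ∈
          localKummerOverOfEmb A 2 (κ.layerSubgroup m) (closureEmb (K := ℚ) (v.adicCompletion ℚ))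
            (signedLocalPoints κ (v.adicCompletion ℚ) A 1 m)) →
      ∀ σ : Field.absoluteGaloisGroup ℚ,
        A.conjH1 2 (κ.layerSubgroup n) σ c ∈
          localKummerOverOfEmb A 2 (κ.layerSubgroup n) (closureEmb (K := ℚ) (v.adicCompletion ℚ))
            (signedLocalPoints κ (v.adicCompletion ℚ) A 1 n)

/-- **S4 · residual `ω⁺ₙ`-control for clean members** (Kobayashi Thm 9.3 at `p = 2` on the `2`-torsion,
exact away from `2` because a semistable curve with odd Tamagawa numbers has no descent defect at
`v ∤ 2` in the cyclotomic `ℤ₂`-tower, Greenberg's `#ker r_v = c_v^{(p)}`): given S3, every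
`s ∈ Sel⁺(A/ℚ_∞)[2]` killed by `(γ-1)^{q⁺ₙ}` comes from `Sel⁺(A/ℚ_n)[2][(γ-1)^{q⁺ₙ}]`, so the former
set is no larger than the latter. -/
def ResidualPlusControl : Prop :=
  PlusKummerDescentAtTwo →
  ∀ (A : WeierstrassCurve ℚ) [A.IsElliptic] [A.IsGloballyMinimal], GoodSS A 2 → A.frobeniusTrace 2 = 0 →
    Squarefree (A.conductorNorm ℤ) → ¬ 2 ∣ A.tamagawaProduct →
    ∀ (κ : ZpExtension ℚ 2) (γ : Field.absoluteGaloisGroup ℚ), κ.IsCyclotomic → κ.IsTopGenerator γ →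
    ∀ (n : ℕ) (Finf : Finset (signedSelmerInfty A κ 1)) (Fn : Finset (A.subgroupH1 2 (κ.layerSubgroup n))),
      (∀ s, s ∈ Finf ↔ (2 • s = 0 ∧ ((conjSignedSelmerInfty A κ 1 γ - 1) ^ qPlus n) s = 0)) →
      (∀ c, c ∈ Fn ↔ (c ∈ signedSelmerLayer A κ 1 n ∧ 2 • c = 0 ∧
        ((conjEnd A (κ.layerSubgroup n) γ - 1) ^ qPlus n) c = 0)) →
      Finf.card ≤ Fn.card

/-- **S5 · layer-zero lower bound**: `Sel_{2^∞}(A/ℚ)[2] ↪ Sel⁺(A/ℚ_∞)[2]^{γ}` (restriction is injective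
because `A(ℚ_∞)[2] = 0` — the `2`-division cubic of a good-supersingular-at-`2` curve with `a₂ = 0` is
irreducible — and `Sel = Sel⁺` at layer `0`). -/
def LayerZeroLowerBound : Prop :=
  ∀ (A : WeierstrassCurve ℚ) [A.IsElliptic] [A.IsGloballyMinimal], GoodSS A 2 → A.frobeniusTrace 2 = 0 →
    ∀ (κ : ZpExtension ℚ 2) (γ : Field.absoluteGaloisGroup ℚ), κ.IsCyclotomic → κ.IsTopGenerator γ →
    ∀ (F1 : Finset (signedSelmerInfty A κ 1)),
      (∀ s, s ∈ F1 ↔ (2 • s = 0 ∧ (conjSignedSelmerInfty A κ 1 γ - 1) s = 0)) →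
      Nat.card {c : A.selmerGroupPInfty 2 // 2 • c = 0} ≤ F1.card

/-- **S6 · the certificate** (per habitat⁺ class; computational, one finite plus-`2`-descent over a
cyclotomic layer `ℚ_n` for ONE clean member `A ≡ W (mod 2)`):
`#Sel⁺(A/ℚ_n)[2][(σ-1)^{q⁺ₙ}] < 2^{q⁺ₙ - 1} · #Sel_{2^∞}(A/ℚ)[2]`. -/
def LayerCertificate : Prop :=
  ∀ (W : WeierstrassCurve ℚ) [W.IsElliptic] [W.IsGloballyMinimal], ¬ W.HasCM → W.analyticRank = 0 →
    GoodSS W 2 → W.frobeniusTrace 2 = 0 → W.Δ < 0 →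
    ∃ (A : WeierstrassCurve ℚ) (_ : A.IsElliptic) (_ : A.IsGloballyMinimal),
      GoodSS A 2 ∧ A.frobeniusTrace 2 = 0 ∧
      (∃ e : WeierstrassCurve.geomTorsion W (2 : ℤ) ≃+ WeierstrassCurve.geomTorsion A (2 : ℤ),
        ∀ (σ : Field.absoluteGaloisGroup ℚ) (P : WeierstrassCurve.geomTorsion W (2 : ℤ)),
          e (σ • P) = σ • e P) ∧
      Squarefree (A.conductorNorm ℤ) ∧ ¬ 2 ∣ A.tamagawaProduct ∧
      ∃ n : ℕ, ∀ (κ : ZpExtension ℚ 2) (γ : Field.absoluteGaloisGroup ℚ), κ.IsCyclotomic → κ.IsTopGenerator γ →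
        ∃ Fn : Finset (A.subgroupH1 2 (κ.layerSubgroup n)),
          (∀ c, c ∈ Fn ↔ (c ∈ signedSelmerLayer A κ 1 n ∧ 2 • c = 0 ∧
            ((conjEnd A (κ.layerSubgroup n) γ - 1) ^ qPlus n) c = 0)) ∧
          Fn.card < 2 ^ (qPlus n - 1) * Nat.card {c : A.selmerGroupPInfty 2 // 2 • c = 0}

theorem stub_residualLayerRank : ResidualLayerRank := by
  sorry

theorem stub_layerFixedDual : LayerFixedDual := by
  sorry

theorem stub_plusKummerDescentAtTwo : PlusKummerDescentAtTwo := by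
  sorry

theorem stub_residualPlusControl : ResidualPlusControl := by
  sorry

theorem stub_layerZeroLowerBound : LayerZeroLowerBound := by
  sorry

theorem stub_layerCertificate : LayerCertificate := by
  sorry

/-- **Composition**: the six stubs imply the crux `SignedMuSeedAtTwoPlus` BY NAME (pure logic plus
the landed `isTorsion_and_mu_eq_zero_iff_finite_quotient`). -/
theorem SignedMuSeedAtTwoPlus_of :
    Summit.BirchSwinnertonDyer.BirchSwinnertonDyer.Theses.ResidualThetaTransportAtTwo.SignedMuSeedAtTwoPlus := by
  have h1 : ResidualLayerRank := stub_residualLayerRank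
  have h2 : LayerFixedDual := stub_layerFixedDual
  have h3 : PlusKummerDescentAtTwo := stub_plusKummerDescentAtTwo
  have h4 : ResidualPlusControl := stub_residualPlusControl
  have h5 : LayerZeroLowerBound := stub_layerZeroLowerBound
  have h6 : LayerCertificate := stub_layerCertificate
  unfold ResidualLayerRank at h1; unfold LayerFixedDual at h2; unfold ResidualPlusControl at h4
  unfold LayerZeroLowerBound at h5; unfold LayerCertificate at h6
  intro W _ _ hCM hrk hss ha2 hΔ
  obtain ⟨A, hAe, hAm, hAss, hAa2, he, hsq, htam, n, hcert⟩ := h6 W hCM hrk hss ha2 hΔ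
  refine ⟨A, hAe, hAm, hAss, hAa2, he, ?_⟩
  intro κ γ hκ hγ D _
  obtain ⟨Fn, hFn, hlt⟩ := hcert κ γ hκ hγ
  obtain ⟨Fq, hFq, hFq_card⟩ := h2 A κ γ 1 hγ D (qPlus n)
  obtain ⟨F1, hF1, hF1_card⟩ := h2 A κ γ 1 hγ D 1
  have hcontrol : Fq.card ≤ Fn.card := h4 h3 A hAss hAa2 hsq htam κ γ hκ hγ n Fq Fn hFq hFn
  have hlow : Nat.card {c : A.selmerGroupPInfty 2 // 2 • c = 0} ≤ F1.card :=
    h5 A hAss hAa2 κ γ hκ hγ F1 (by simpa only [pow_one] using hF1)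
  have hineq : Nat.card (D.X ⧸ (layerIdeal 2 (qPlus n) • ⊤ : Submodule (IwasawaAlgebra 2) D.X)) <
      2 ^ (qPlus n - 1) * Nat.card (D.X ⧸ (layerIdeal 2 1 • ⊤ : Submodule (IwasawaAlgebra 2) D.X)) := by
    rw [← hFq_card, ← hF1_card]
    calc Fq.card ≤ Fn.card := hcontrol
      _ < 2 ^ (qPlus n - 1) * Nat.card {c : A.selmerGroupPInfty 2 // 2 • c = 0} := hlt
      _ ≤ 2 ^ (qPlus n - 1) * F1.card := Nat.mul_le_mul_left _ hlow
  have hq : 1 ≤ qPlus n := by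
    unfold qPlus
    have h := Nat.one_le_two_pow (n := 2 * (n / 2))
    rw [pow_succ]
    omega
  have hfin : Finite (D.X ⧸ (augIdealP 2 • ⊤ : Submodule (IwasawaAlgebra 2) D.X)) :=
    h1 2 D.X (qPlus n) hq hineq
  exact (isTorsion_and_mu_eq_zero_iff_finite_quotient D).mpr hfin

end Summit.BirchSwinnertonDyer.BirchSwinnertonDyer.Cruxes.SignedMuSeedAtTwoPlus.LayerRankCertificate
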